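import Mathlib
import Summits.ValiantsHypothesis.ValiantsHypothesis.Theorems.NewtonUnitEquationsTwoProductsRadixResidueOff

/-!
# Radix class minimiser: the `w`-lightest point of a residue class of `supp (F * expand M C)`
# is a monomial of `F`

For a multiscale product `P = F * expand M C` (where `MvPolynomial.expand M` substitutes
`x ↦ x^M`, `y ↦ y^M`) with `M ≥ 1` and `C(0) ≠ 0`, and a strictly positive weight `w`, a support
point `e` of `P` that is strictly `w`-lighter than every other support point of `P` in its own
residue class modulo `M` (coordinatewise residues) is a support point of the fine factor `F`.

Proof.  Every support point of `P` is `a + M • b` with `a ∈ supp F`, `b ∈ supp C`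
(`MvPolynomial.coeff_mul`, `MvPolynomial.support_expand`, packaged as
`RadixResidueOff.term_ne_zero`), so `a ≡ e (mod M)` coordinatewise.  Among the monomials of `F`
in the residue class of `e` pick a `w`-lightest one, `d₀`.  In the Cauchy product for
`coeff d₀ P` only the term `(d₀, 0)` survives: any other nonzero term `(a, M • b)` with `b ≠ 0`
would put the strictly lighter monomial `a` of `F` in the same class.  Hence
`coeff d₀ P = F_{d₀} · C_0 ≠ 0`, so `d₀` is a support point of `P` in the class of `e`.  Strict
minimality of `e` inside its class then forces `e = d₀`: otherwise `wt e < wt d₀ ≤ wt a ≤ wt e`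
for the decomposition `e = a + M • b`.

This is the class-restricted companion of the landed off-lattice statement
`RadixResidueOff.stub_radixResidueOff`; the helpers `term_ne_zero`, `mod_add_smul_apply`,
`wt_add_smul` (module `NewtonUnitEquationsTwoProductsRadixResidueOff`) and the weight positivity
facts `wt_nonneg`, `wt_pos` (module `NewtonUnitEquationsTwoProductsDepthOne`) are reused.
-/

set_option linter.dupNamespace false

namespace Summit.ValiantsHypothesis.ValiantsHypothesis.Theorems.TwoProducts.RadixClassMin

open MvPolynomial

/-- For `M ≠ 0`, `C(0) ≠ 0` and a strictly positive weight `w`: if `d₀` is a `w`-lightest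
monomial of `F` within its residue class modulo `M`, then the only surviving Cauchy term of
`coeff d₀ (F * expand M C)` is `(d₀, 0)`, i.e. `coeff d₀ (F * expand M C) = F_{d₀} · C_0`. -/
theorem coeff_mul_expand_classMin {M : ℕ} (hM : M ≠ 0) (F C : MvPolynomial (Fin 2) ℂ)
    (w : Fin 2 → ℤ) (hw0 : 0 < w 0) (hw1 : 0 < w 1) (d₀ : Fin 2 →₀ ℕ)
    (hmin : ∀ a : Fin 2 →₀ ℕ, coeff a F ≠ 0 → a 0 % M = d₀ 0 % M → a 1 % M = d₀ 1 % M →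
      w 0 * (d₀ 0 : ℤ) + w 1 * (d₀ 1 : ℤ) ≤ w 0 * (a 0 : ℤ) + w 1 * (a 1 : ℤ)) :
    coeff d₀ (F * expand M C) = coeff d₀ F * coeff 0 C := by
  classical
  rw [coeff_mul, Finset.sum_eq_single (d₀, (0 : Fin 2 →₀ ℕ))]
  · rw [coeff_expand_zero M hM]
  · intro y hy hyne
    by_contra hyz
    obtain ⟨hya, b', _, hyb⟩ := RadixResidueOff.term_ne_zero hM F C y hyz
    rw [Finset.HasAntidiagonal.mem_antidiagonal] at hy
    have hb'ne : b' ≠ 0 := by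
      rintro rfl
      apply hyne
      have hy2 : y.2 = 0 := by rw [hyb, smul_zero]
      have hy1 : y.1 = d₀ := by rw [← hy, hy2, add_zero]
      exact Prod.ext hy1 hy2
    have hy10 : y.1 0 % M = d₀ 0 % M := by
      rw [← hy, hyb, RadixResidueOff.mod_add_smul_apply]
    have hy11 : y.1 1 % M = d₀ 1 % M := by
      rw [← hy, hyb, RadixResidueOff.mod_add_smul_apply]
    have h1 : w 0 * (d₀ 0 : ℤ) + w 1 * (d₀ 1 : ℤ) ≤ w 0 * (y.1 0 : ℤ) + w 1 * (y.1 1 : ℤ) :=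
      hmin y.1 hya hy10 hy11
    have h2 : w 0 * (d₀ 0 : ℤ) + w 1 * (d₀ 1 : ℤ) = (w 0 * (y.1 0 : ℤ) + w 1 * (y.1 1 : ℤ)) +
        (M : ℤ) * (w 0 * (b' 0 : ℤ) + w 1 * (b' 1 : ℤ)) := by
      rw [← hy, hyb]
      exact RadixResidueOff.wt_add_smul w M y.1 b'
    have h3 := DepthOne.wt_pos w hw0 hw1 b' hb'ne
    have hM' : (1 : ℤ) ≤ M := by exact_mod_cast Nat.one_le_iff_ne_zero.mpr hM
    nlinarith
  · intro h
    exact absurd (Finset.HasAntidiagonal.mem_antidiagonal.mpr (add_zero d₀)) h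

/-- **Radix class minimiser.**  For `M ≥ 1`, bivariate polynomials `F`, `C` with `C(0) ≠ 0`
and a strictly positive weight `w`: if `e` is a support point of `F * expand M C` that is
strictly `w`-lighter than every other support point of `F * expand M C` with the same
coordinatewise residues modulo `M`, then `e ∈ supp F`. -/
theorem stub_radixClassMin : ∀ (M : ℕ) (F C : MvPolynomial (Fin 2) ℂ), 1 ≤ M →
    MvPolynomial.coeff 0 C ≠ 0 →
    ∀ (w : Fin 2 → ℤ), 0 < w 0 → 0 < w 1 → ∀ e ∈ (F * MvPolynomial.expand M C).support,
    (∀ q ∈ (F * MvPolynomial.expand M C).support, q ≠ e → q 0 % M = e 0 % M →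
      q 1 % M = e 1 % M →
      w 0 * (e 0 : ℤ) + w 1 * (e 1 : ℤ) < w 0 * (q 0 : ℤ) + w 1 * (q 1 : ℤ)) →
    e ∈ F.support := by
  intro M F C hM hC0 w hw0 hw1 e heP hmin
  classical
  have hMne : M ≠ 0 := Nat.one_le_iff_ne_zero.mp hM
  -- Step 1: `e = a + M • b` with `F_a ≠ 0`, `C_b ≠ 0`.
  have heP' : coeff e (F * expand M C) ≠ 0 := mem_support_iff.mp heP
  rw [coeff_mul] at heP'
  obtain ⟨x, hx, hxne⟩ := Finset.exists_ne_zero_of_sum_ne_zero heP'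
  obtain ⟨hxa, b, _, hxb⟩ := RadixResidueOff.term_ne_zero hMne F C x hxne
  rw [Finset.HasAntidiagonal.mem_antidiagonal] at hx
  -- The residue class of `e` inside `supp F`.
  set T : Finset (Fin 2 →₀ ℕ) :=
    F.support.filter (fun d => d 0 % M = e 0 % M ∧ d 1 % M = e 1 % M) with hT
  have hmemT : ∀ d, d ∈ T ↔ coeff d F ≠ 0 ∧ d 0 % M = e 0 % M ∧ d 1 % M = e 1 % M := by
    intro d
    rw [hT, Finset.mem_filter, mem_support_iff]
  have haT : x.1 ∈ T := by
    rw [hmemT]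
    refine ⟨hxa, ?_, ?_⟩
    · rw [← hx, hxb, RadixResidueOff.mod_add_smul_apply]
    · rw [← hx, hxb, RadixResidueOff.mod_add_smul_apply]
  -- Step 2: a `w`-lightest element `d₀` of the class.
  obtain ⟨d₀, hd₀T, hd₀min⟩ :=
    T.exists_min_image (fun d => w 0 * (d 0 : ℤ) + w 1 * (d 1 : ℤ)) ⟨x.1, haT⟩
  obtain ⟨hd₀F, hd₀0, hd₀1⟩ := (hmemT d₀).mp hd₀T
  -- Step 3: `coeff d₀ P = F_{d₀} * C_0`, so `d₀ ∈ supp P`.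
  have hcoeff : coeff d₀ (F * expand M C) = coeff d₀ F * coeff 0 C := by
    refine coeff_mul_expand_classMin hMne F C w hw0 hw1 d₀ ?_
    intro a ha ha0 ha1
    refine hd₀min a ((hmemT a).mpr ⟨ha, ?_, ?_⟩)
    · rw [ha0, hd₀0]
    · rw [ha1, hd₀1]
  have hd₀P : d₀ ∈ (F * expand M C).support := by
    rw [mem_support_iff, hcoeff]
    exact mul_ne_zero hd₀F hC0
  -- Step 4: strict minimality of `e` inside its class forces `e = d₀`.
  by_cases hde : d₀ = e
  · rw [← hde]
    exact mem_support_iff.mpr hd₀F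
  · exfalso
    have hlt := hmin d₀ hd₀P hde hd₀0 hd₀1
    have h1 : w 0 * (d₀ 0 : ℤ) + w 1 * (d₀ 1 : ℤ) ≤ w 0 * (x.1 0 : ℤ) + w 1 * (x.1 1 : ℤ) :=
      hd₀min x.1 haT
    have h2 : w 0 * (e 0 : ℤ) + w 1 * (e 1 : ℤ) = (w 0 * (x.1 0 : ℤ) + w 1 * (x.1 1 : ℤ)) +
        (M : ℤ) * (w 0 * (b 0 : ℤ) + w 1 * (b 1 : ℤ)) := by
      rw [← hx, hxb]
      exact RadixResidueOff.wt_add_smul w M x.1 b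
    have h3 := DepthOne.wt_nonneg w hw0 hw1 b
    have hM' : (0 : ℤ) ≤ M := by positivity
    nlinarith

end Summit.ValiantsHypothesis.ValiantsHypothesis.Theorems.TwoProducts.RadixClassMin
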